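import Literature.Barriers.QuantumAdvantage.BoundedEntanglement
import Literature.Computability.QuantumComplexity.RevTableau
import Summits.QuantumAdvantage.QuantumAdvantage.Theorems.SymplecticPurityDefs

/-!
# Route `SymplecticPurity`, item `NoFreeFrame` — the final state of the witness family

On the all-zero input of length `n ≥ 1` the witness family `cubeFamily` ends (after all its gates) in
the normalised graph state of the Boolean map `cubeMap n` computed by its reversible part:

  `cubeFamily.stateAfter 0ⁿ (size) = z ↦ [z|ancillas = cubeMap n (z|inputs)] · 2^{-n/2}`.

Ingredients: the Hadamard layer on the input wires (`hadamards_mulVec_basisState`), the exact classical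
action of compiled reversible programs (`revCompile_mulVec_basisState`, `revEval_toRevList`,
`RevSim.clEval_map_finOf_apply`) and the invariance of the input register under `cubeOpsA n` (its
targets are ancilla wires).
-/

noncomputable section

set_option linter.dupNamespace false -- D-0017: single-problem summit ⇒ `QuantumAdvantage.QuantumAdvantage` by design

namespace Summit.QuantumAdvantage.QuantumAdvantage.Theorems.SymplecticPurity

open Matrix
open Literature.Computability.QuantumComplexity Literature.Computability.Cryptography

/-! ### The input register is untouched -/

/-- Every target of the cube program is an ancilla wire (`≥ n`). -/
theorem le_target_of_mem_cubeOpsA {n : ℕ} {op : ClOp ℕ} (hop : op ∈ cubeOpsA n) : n ≤ op.target := by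
  simp only [cubeOpsA, cubeLinOps, cubeQuadOps, List.mem_append, List.mem_flatMap, List.mem_map,
    List.mem_range] at hop
  rcases hop with ⟨a, -, l, -, rfl⟩ | ⟨a, -, b, -, hop⟩
  · show n ≤ n + l; omega
  · split_ifs at hop
    · simp at hop
    · rw [List.mem_map] at hop
      obtain ⟨l, -, rfl⟩ := hop
      show n ≤ n + l; omega

/-- The cube program does not change the input register. -/
theorem clEval_cubeOpsA_of_lt {n : ℕ} (w : ℕ → Bool) {i : ℕ} (hi : i < n) :
    clEval (cubeOpsA n) w i = w i :=
  clEval_apply_of_forall_target_ne _ _ fun op hop h => by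
    have := le_target_of_mem_cubeOpsA hop; omega

/-! ### The classical action of the transported program -/

section Fin

variable {n : ℕ} (hn : 0 < n + n)

/-- On `Fin (n + n)` wires: the input register is untouched. -/
theorem clEval_cubeOpsFin_castAdd (w : QReg (n + n)) (i : Fin n) :
    clEval (cubeOpsFin n hn) w (Fin.castAdd n i) = w (Fin.castAdd n i) := by
  rw [cubeOpsFin, RevSim.clEval_map_finOf_apply hn _ cubeOpsA_wires, Fin.val_castAdd,
    clEval_cubeOpsA_of_lt _ i.isLt]
  exact RevSim.liftW_val w (Fin.castAdd n i)

/-- On `Fin (n + n)` wires, started on `|y⟩|0ⁿ⟩`: the ancilla register ends in `cubeMap n y`. -/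
theorem clEval_cubeOpsFin_natAdd (y : QReg n) (l : Fin n) :
    clEval (cubeOpsFin n hn) (padInput y n) (Fin.natAdd n l) = cubeMap n y l := by
  rw [cubeOpsFin, RevSim.clEval_map_finOf_apply hn _ cubeOpsA_wires, Fin.val_natAdd]
  rfl

/-- The transported program maps `|y⟩|0ⁿ⟩` to `|y⟩|cubeMap n y⟩`. -/
theorem clEval_cubeOpsFin_padInput (y : QReg n) :
    clEval (cubeOpsFin n hn) (padInput y n) = Fin.append y (cubeMap n y) := by
  funext p
  refine Fin.addCases (fun i => ?_) (fun l => ?_) p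
  · rw [clEval_cubeOpsFin_castAdd, Fin.append_left]
    show Fin.append y (fun _ => false) (Fin.castAdd n i) = y i
    rw [Fin.append_left]
  · rw [clEval_cubeOpsFin_natAdd, Fin.append_right]

end Fin

/-! ### The final state -/

/-- A register label as the append of its two halves. -/
theorem append_halves {n : ℕ} (z : QReg (n + n)) :
    Fin.append (fun i => z (Fin.castAdd n i)) (fun l => z (Fin.natAdd n l)) = z :=
  Fin.append_castAdd_natAdd

/-- The padded all-zero input is the all-zero label. -/
theorem padInput_get_eq_false (x : List Bool) (hx : ∀ i, x.get i = false) (m : ℕ)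
    (i : Fin (x.length + m)) : padInput x.get m i = false := by
  unfold padInput
  induction i using Fin.addCases with
  | left i => rw [Fin.append_left]; exact hx i
  | right i => rw [Fin.append_right]

/-- **The final state of the witness family on `0ⁿ`** (`n ≥ 1`): the normalised graph state of
`cubeMap n`, i.e. amplitude `2^{-n/2}` on the labels `|y⟩|cubeMap n y⟩` and `0` elsewhere. -/
theorem cubeFamily_stateAfter (x : List Bool) (hx : ∀ i, x.get i = false) (hn : 0 < x.length) :
    cubeFamily.stateAfter x (cubeGates x.length).length = fun z : QReg (x.length + x.length) =>
      if (fun l => z (Fin.natAdd x.length l)) = cubeMap x.length (fun i => z (Fin.castAdd x.length i))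
      then invSqrt2 ^ x.length else 0 := by
  set n := x.length with hndef
  have hnn : 0 < n + n := by omega
  -- the circuit, with the `dite` resolved
  have hgates : cubeGates n = (List.finRange n).map (fun i => hOn (Fin.castAdd n i)) ++
      revCompile (toRevList (cubeOpsFin n hnn) (cubeOpsFin_wf n hnn)) := by
    simp [cubeGates, hnn]
  -- unfold `stateAfter`: all gates are applied
  show QCircuit.runOn 0 (⟨(cubeGates n).take (cubeGates n).length⟩ : QCircuit cliffordT (n + n))
      (basisState (padInput x.get n)) = _
  have htake : (cubeGates n).take (cubeGates n).length = cubeGates n := List.take_length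
  rw [htake, hgates, show (⟨(List.finRange n).map (fun i => hOn (Fin.castAdd n i)) ++
      revCompile (toRevList (cubeOpsFin n hnn) (cubeOpsFin_wf n hnn))⟩ : QCircuit cliffordT (n + n)) =
      (⟨(List.finRange n).map (fun i => hOn (Fin.castAdd n i))⟩ : QCircuit cliffordT (n + n)).append
        ⟨revCompile (toRevList (cubeOpsFin n hnn) (cubeOpsFin_wf n hnn))⟩ from rfl,
    QCircuit.runOn, QCircuit.toMatrix_append, ← Matrix.mulVec_mulVec]
  -- the Hadamard layer
  have hws : ((List.finRange n).map (Fin.castAdd n)).Nodup :=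
    (List.nodup_finRange n).map (Fin.castAdd_injective n n)
  have h0 : ∀ i, padInput x.get n i = false := padInput_get_eq_false x hx n
  have hH := hadamards_mulVec_basisState ((List.finRange n).map (Fin.castAdd n)) hws
    (padInput x.get n) (fun i _ => h0 i)
  rw [List.map_map] at hH
  rw [show (fun i => hOn (Fin.castAdd n i)) = hOn ∘ Fin.castAdd n from rfl, hH, List.length_map,
    List.length_finRange]
  -- the reversible part, entrywise
  funext z
  set A := QCircuit.toMatrix 0
    (⟨revCompile (toRevList (cubeOpsFin n hnn) (cubeOpsFin_wf n hnn))⟩ : QCircuit cliffordT (n + n))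
    with hAdef
  set F : QReg (n + n) → QReg (n + n) := clEval (cubeOpsFin n hnn) with hFdef
  -- columns of `A`: `A |z'⟩ = |F z'⟩`
  have hcol : ∀ z' : QReg (n + n), A z z' = if z = F z' then 1 else 0 := by
    intro z'
    have : A z z' = (A *ᵥ basisState z') z := by rw [mulVec_basisState]
    rw [this, hAdef, revCompile_mulVec_basisState, revEval_toRevList, basisState_apply]
  -- the vector after the Hadamard layer, rewritten on the ancilla register
  have hanc : ∀ z' : QReg (n + n), (∀ j, j ∉ (List.finRange n).map (Fin.castAdd n) →
      z' j = padInput x.get n j) ↔ (fun l => z' (Fin.natAdd n l)) = fun _ => false := by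
    intro z'
    constructor
    · intro h
      funext l
      rw [h _ (fun hm => ?_), h0]
      obtain ⟨i, -, hi⟩ := List.mem_map.1 hm
      have := congrArg Fin.val hi
      simp at this
      omega
    · intro h j hj
      rw [h0]
      induction j using Fin.addCases with
      | left i => exact absurd (List.mem_map.2 ⟨i, List.mem_finRange i, rfl⟩) hj
      | right l => exact congrFun h l
  simp only [Matrix.mulVec, dotProduct, hcol, hanc]
  -- only `z₀ = |z.inputs⟩|0ⁿ⟩` contributes
  set y : QReg n := fun i => z (Fin.castAdd n i) with hydef
  have hFpad : F (padInput y n) = Fin.append y (cubeMap n y) := clEval_cubeOpsFin_padInput hnn y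
  rw [Finset.sum_eq_single (padInput y n)]
  · -- the value at `z₀`
    have hz0 : (fun l => padInput y n (Fin.natAdd n l)) = fun _ => false := by
      funext l; exact Fin.append_right _ _ _
    rw [if_pos hz0, hFpad]
    by_cases h : (fun l => z (Fin.natAdd n l)) = cubeMap n y
    · rw [if_pos h, if_pos, one_mul]
      rw [← append_halves z, h]
    · rw [if_neg h, if_neg, zero_mul]
      intro h'
      apply h
      funext l
      have := congrFun h' (Fin.natAdd n l)
      rwa [Fin.append_right] at this
  · -- every other `z'` contributes `0`
    intro z' _ hne
    by_cases hz' : (fun l => z' (Fin.natAdd n l)) = fun _ => false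
    · rw [if_pos hz', if_neg, zero_mul]
      intro hzF
      apply hne
      have e : z' = padInput (fun i => z' (Fin.castAdd n i)) n := by
        conv_lhs => rw [← append_halves z']
        rw [hz']; rfl
      have hy : (fun i => z' (Fin.castAdd n i)) = y := by
        funext i
        have := congrFun hzF (Fin.castAdd n i)
        rw [e, hFdef, clEval_cubeOpsFin_padInput hnn, Fin.append_left] at this
        exact this.symm
      rw [e, hy]
    · rw [if_neg hz', mul_zero]
  · exact fun h => absurd (Finset.mem_univ _) h

end Summit.QuantumAdvantage.QuantumAdvantage.Theorems.SymplecticPurity
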